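import Literature.Analysis.PDE.SobolevLeibnizSharp
import Literature.Analysis.PDE.SobolevLeibnizCLM
import Mathlib.Analysis.Calculus.ContDiff.Bounds
import HarnessLib

/-!
# High–low Leibniz bounds for Sobolev energies of bilinear pairings (topic `Analysis/PDE`)

Analytic layer (III) of the programme to prove short-time existence for quasilinear strictly
parabolic systems on a closed manifold (hypothesis `hQL` of
`Literature.Geometry.Riemannian.ricciFlow_shortTime_existence_of_quasilinear`). The nonlinear
estimates of the frozen Picard scheme are products `B(φ, ψ)` of a coefficient-type factor `φ`
(a composition with the jet of an iterate) and a solution-type factor `ψ` (second derivatives of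
an iterate or of a difference); closing the scheme at a fixed Sobolev level `K` without tame
interpolation requires the **high–low split**: in the Leibniz expansion of `Dᴷ B(φ, ψ)` the
factor carrying few derivatives is put in the sup norm and the other in `L²`.

* `sobolevEnergy_bilinear_highlow` — for every `K` there is `C < ∞` (dimension and `K` only)
  such that for every continuous bilinear `B`, smooth `φ, ψ`, and every split `h ≤ K + 1`,
  `E_K(B(φ, ψ)) ≤ C ‖B‖² [Σ_{j<h} (M_j)² E_{K-j}(ψ) + N² Σ_{h≤j≤K} E_j(φ)]` whenever
  `‖Dʲφ‖ ≤ M_j` (`j < h`) and `‖Dᵐψ‖ ≤ N` (`m + h ≤ K + 1`) pointwise;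
* `sobolevEnergy_bilinear_highlow_sharp` — the same with the top coefficient `(1 + ε) ‖B‖² M₀²`
  in front of `E_K(ψ)` (`h ≥ 1`).

Both are proved by induction on `K` from the product rule for one derivative; no Leibniz formula
for words is used. Everything is proved; no named fact and no `sorry` is introduced.

## References

* L. C. Evans, *Partial Differential Equations*, 2nd ed., AMS 2010, §5.2.3, Thm. 1 and §5.6.
  [Evans2010]
* M. E. Taylor, *Partial Differential Equations III*, 2nd ed., Springer 2011, Ch. 13, §3,
  Prop. 3.6 (Moser estimates). [TaylorPDEIII2011]
-/

noncomputable section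

open MeasureTheory Set Function Filter
open scoped ENNReal ContDiff

namespace Literature.Analysis.PDE

open Literature.Analysis.FunctionSpaces

variable {E : Type*} [NormedAddCommGroup E] [InnerProductSpace ℝ E] [FiniteDimensional ℝ E]
  [MeasurableSpace E] [BorelSpace E]
variable {G₁ : Type*} [NormedAddCommGroup G₁] [NormedSpace ℝ G₁]
variable {G₂ : Type*} [NormedAddCommGroup G₂] [NormedSpace ℝ G₂]
variable {F : Type*} [NormedAddCommGroup F] [NormedSpace ℝ F]

/-! ### One derivative of the pieces -/

omit [MeasurableSpace E] [BorelSpace E] in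
/-- Iterated derivatives of a frame derivative: `‖Dʲ(∂ᵢ φ)(x)‖ ≤ ‖D^{j+1} φ(x)‖`. [folklore] -/
theorem norm_iteratedFDeriv_fderiv_frame_le {φ : E → G₁} (hφ : ContDiff ℝ ∞ φ) (j : ℕ) (i : Fin (Module.finrank ℝ E)) (x : E) :
    ‖iteratedFDeriv ℝ j (fun y ↦ fderiv ℝ φ y (stdOrthonormalBasis ℝ E i)) x‖ ≤ ‖iteratedFDeriv ℝ (j + 1) φ x‖ := by
  have h1 := norm_iteratedFDeriv_clm_apply_const (f := fderiv ℝ φ) (c := stdOrthonormalBasis ℝ E i) (x := x) (N := ∞) (n := j)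
    ((hφ.fderiv_right (m := ∞) (by norm_cast)).contDiffAt) (by exact_mod_cast le_top)
  refine h1.trans ?_
  rw [(stdOrthonormalBasis ℝ E).orthonormal.1 i, one_mul, norm_iteratedFDeriv_fderiv]

/-- Energies of frame derivatives: `Σᵢ E_j(∂ᵢ φ) ≤ E_{j+1}(φ)`. [folklore] -/
theorem sum_sobolevEnergy_fderiv_frame_le (j : ℕ) (φ : E → G₁) :
    ∑ i, sobolevEnergy j (fun y ↦ fderiv ℝ φ y (stdOrthonormalBasis ℝ E i)) ≤ sobolevEnergy (j + 1) φ := by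
  rw [sobolevEnergy_succ]; exact le_add_self

/-- Shifted energy sums: `Σ_{j ∈ [a, b)} E_{j+1}(φ) ≤ Σ_{j ∈ [a+1, b+1)} E_j(φ)` (equality). [folklore] -/
theorem sum_Ico_sobolevEnergy_succ (a b : ℕ) (φ : E → G₁) :
    ∑ j ∈ Finset.Ico a b, sobolevEnergy (j + 1) φ = ∑ j ∈ Finset.Ico (a + 1) (b + 1), sobolevEnergy j φ :=
  Finset.sum_Ico_add' (fun j ↦ sobolevEnergy j φ) a b 1

omit [FiniteDimensional ℝ E] [MeasurableSpace E] [BorelSpace E] in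
/-- The product rule for a bilinear pairing along a vector:
`∂ᵥ B(φ, ψ) = B(∂ᵥφ, ψ) + B(φ, ∂ᵥψ)`. [folklore] -/
theorem fderiv_bilinear_apply [FiniteDimensional ℝ E] (B : G₁ →L[ℝ] G₂ →L[ℝ] F) {φ : E → G₁} {ψ : E → G₂} (hφ : ContDiff ℝ ∞ φ)
    (hψ : ContDiff ℝ ∞ ψ) (x v : E) :
    fderiv ℝ (fun y ↦ B (φ y) (ψ y)) x v = B (fderiv ℝ φ x v) (ψ x) + B (φ x) (fderiv ℝ ψ x v) := by
  have h := fderiv_clm_apply_eq (B := fun y ↦ B (φ y)) (B.contDiff.comp hφ) hψ x v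
  rw [h, add_comm]
  congr 1
  have hd : DifferentiableAt ℝ φ x := (hφ.differentiable (by simp)) x
  rw [show (fun y ↦ B (φ y)) = B ∘ φ from rfl, fderiv_comp x B.differentiableAt hd, B.fderiv]
  rfl

/-! ### The high–low bound -/

/-- **The high–low quantity** of the split `h`: sup bounds on `φ` below `h`, energies of `φ` from
`h` to `K`. [cite: TaylorPDEIII2011, Ch. 13, Prop. 3.6] -/
def highLowQ (K h : ℕ) (Mφ : ℕ → ℝ) (Nψ : ℝ) (φ : E → G₁) (ψ : E → G₂) : ℝ≥0∞ :=
  (∑ j ∈ Finset.range h, ENNReal.ofReal (Mφ j ^ 2) * sobolevEnergy (K - j) ψ) +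
    ENNReal.ofReal (Nψ ^ 2) * ∑ j ∈ Finset.Ico h (K + 1), sobolevEnergy j φ

omit [FiniteDimensional ℝ E] [MeasurableSpace E] [BorelSpace E] in
/-- `highLowQ_eq`: unfolding. [folklore] -/
theorem highLowQ_eq [FiniteDimensional ℝ E] [MeasurableSpace E] [BorelSpace E] (K h : ℕ) (Mφ : ℕ → ℝ) (Nψ : ℝ) (φ : E → G₁) (ψ : E → G₂) :
    highLowQ K h Mφ Nψ φ ψ = (∑ j ∈ Finset.range h, ENNReal.ofReal (Mφ j ^ 2) * sobolevEnergy (K - j) ψ) +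
      ENNReal.ofReal (Nψ ^ 2) * ∑ j ∈ Finset.Ico h (K + 1), sobolevEnergy j φ := rfl

/-- **High–low Leibniz bound for bilinear pairings.** For every `K` there is `C < ∞` such that
for every continuous bilinear `B`, smooth `φ, ψ`, split `h ≤ K + 1`, and bounds `‖Dʲφ‖ ≤ M_j`
(`j < h`), `‖Dᵐψ‖ ≤ N` (`m + h ≤ K`):
`E_K(B(φ, ψ)) ≤ C ‖B‖² highLowQ K h M N φ ψ`. [cite: TaylorPDEIII2011, Ch. 13, Prop. 3.6] -/
theorem sobolevEnergy_bilinear_highlow (K : ℕ) :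
    ∃ C : ℝ≥0∞, C ≠ ⊤ ∧ ∀ (B : G₁ →L[ℝ] G₂ →L[ℝ] F) {φ : E → G₁} {ψ : E → G₂}, ContDiff ℝ ∞ φ → ContDiff ℝ ∞ ψ →
      ∀ {h : ℕ}, h ≤ K + 1 → ∀ {Mφ : ℕ → ℝ} {Nψ : ℝ}, (∀ j < h, ∀ x, ‖iteratedFDeriv ℝ j φ x‖ ≤ Mφ j) → 0 ≤ Nψ →
        (∀ m, m + h ≤ K → ∀ x, ‖iteratedFDeriv ℝ m ψ x‖ ≤ Nψ) →
        sobolevEnergy K (fun x ↦ B (φ x) (ψ x)) ≤ C * ENNReal.ofReal (‖B‖ ^ 2) * highLowQ K h Mφ Nψ φ ψ := by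
  set n : ℝ≥0∞ := (Module.finrank ℝ E : ℝ≥0∞) with hn
  induction K with
  | zero =>
    refine ⟨1, ENNReal.one_ne_top, ?_⟩
    intro B φ ψ hφ hψ h hh Mφ Nψ hM hN0 hN
    rw [one_mul, highLowQ_eq]
    rcases Nat.eq_zero_or_pos h with rfl | hpos
    · -- all of `φ` in `L²`: swap the factors
      have hsup : ∀ x, ‖B.flip (ψ x)‖ ≤ ‖B‖ * Nψ := fun x ↦ by
        refine (B.flip.le_opNorm _).trans ?_
        rw [B.opNorm_flip]
        refine mul_le_mul_of_nonneg_left ?_ (norm_nonneg B)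
        have h0 := hN 0 (by omega) x
        rwa [norm_iteratedFDeriv_zero] at h0
      have h1 := sobolevEnergy_clm_apply_le_zero (B := fun x ↦ B.flip (ψ x)) hsup φ
      simp only [ContinuousLinearMap.flip_apply] at h1
      refine h1.trans ?_
      simp only [Finset.range_zero, Finset.sum_empty, zero_add, show Finset.Ico 0 (0 + 1) = {0} by rfl, Finset.sum_singleton]
      rw [mul_pow, ENNReal.ofReal_mul (sq_nonneg _), mul_assoc]
    · -- `h = 1`: `φ` in sup
      have h1' : h = 1 := by omega
      subst h1'
      have hsup : ∀ x, ‖B (φ x)‖ ≤ ‖B‖ * Mφ 0 := fun x ↦ by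
        refine (B.le_opNorm _).trans (mul_le_mul_of_nonneg_left ?_ (norm_nonneg B))
        have h0 := hM 0 (by omega) x
        rwa [norm_iteratedFDeriv_zero] at h0
      have h1 := sobolevEnergy_clm_apply_le_zero (B := fun x ↦ B (φ x)) hsup ψ
      refine h1.trans ?_
      simp only [Finset.range_one, Finset.sum_singleton, Nat.sub_zero]
      rw [mul_pow, ENNReal.ofReal_mul (sq_nonneg _), mul_assoc]
      exact mul_le_mul' le_rfl le_self_add
  | succ K ih =>
    obtain ⟨C, hCtop, hC⟩ := ih
    refine ⟨1 + 2 * n * C + 2 * C, ?_, ?_⟩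
    · exact ENNReal.add_ne_top.2 ⟨ENNReal.add_ne_top.2 ⟨ENNReal.one_ne_top, ENNReal.mul_ne_top (ENNReal.mul_ne_top (by simp) (by simp [hn])) hCtop⟩,
        ENNReal.mul_ne_top (by simp) hCtop⟩
    intro B φ ψ hφ hψ h hh Mφ Nψ hM hN0 hN
    set e := stdOrthonormalBasis ℝ E with he
    have hφi : ∀ i, ContDiff ℝ ∞ fun y ↦ fderiv ℝ φ y (e i) := fun i ↦ (hφ.fderiv_right (m := ∞) (by norm_cast)).clm_apply contDiff_const
    have hψi : ∀ i, ContDiff ℝ ∞ fun y ↦ fderiv ℝ ψ y (e i) := fun i ↦ (hψ.fderiv_right (m := ∞) (by norm_cast)).clm_apply contDiff_const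
    -- the product rule
    have hprod : ∀ i, (fun x ↦ fderiv ℝ (fun y ↦ B (φ y) (ψ y)) x (e i)) =
        fun x ↦ B (fderiv ℝ φ x (e i)) (ψ x) + B (φ x) (fderiv ℝ ψ x (e i)) := fun i ↦ funext fun x ↦ fderiv_bilinear_apply B hφ hψ x _
    rw [sobolevEnergy_succ]
    simp only [hprod, ← he]
    -- the two kinds of terms at level `K`
    have hBφ : ∀ i, ContDiff ℝ K fun x ↦ B (fderiv ℝ φ x (e i)) (ψ x) := fun i ↦
      ((B.contDiff.comp (hφi i)).clm_apply hψ).of_le (by exact_mod_cast le_top)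
    have hBψ : ∀ i, ContDiff ℝ K fun x ↦ B (φ x) (fderiv ℝ ψ x (e i)) := fun i ↦
      ((B.contDiff.comp hφ).clm_apply (hψi i)).of_le (by exact_mod_cast le_top)
    have hsum : ∑ i, sobolevEnergy K (fun x ↦ B (fderiv ℝ φ x (e i)) (ψ x) + B (φ x) (fderiv ℝ ψ x (e i))) ≤
        2 * ∑ i, sobolevEnergy K (fun x ↦ B (fderiv ℝ φ x (e i)) (ψ x)) + 2 * ∑ i, sobolevEnergy K (fun x ↦ B (φ x) (fderiv ℝ ψ x (e i))) := by
      rw [Finset.mul_sum, Finset.mul_sum, ← Finset.sum_add_distrib]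
      exact Finset.sum_le_sum fun i _ ↦ sobolevEnergy_add_le K (hBφ i) (hBψ i)
    rcases Nat.eq_zero_or_pos h with rfl | hpos
    · /- `h = 0`: all of `φ` in `L²` -/
      have hNm : ∀ m ≤ K + 1, ∀ x, ‖iteratedFDeriv ℝ m ψ x‖ ≤ Nψ := fun m hm x ↦ hN m (by omega) x
      -- zeroth term
      have hsup : ∀ x, ‖B.flip (ψ x)‖ ≤ ‖B‖ * Nψ := fun x ↦ by
        refine (B.flip.le_opNorm _).trans ?_
        rw [B.opNorm_flip]
        refine mul_le_mul_of_nonneg_left ?_ (norm_nonneg B)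
        have h0 := hNm 0 (by omega) x
        rwa [norm_iteratedFDeriv_zero] at h0
      have h0 : (∫⁻ x, ‖B (φ x) (ψ x)‖ₑ ^ 2) ≤ ENNReal.ofReal ((‖B‖ * Nψ) ^ 2) * sobolevEnergy 0 φ := by
        have h1 := sobolevEnergy_clm_apply_le_zero (B := fun x ↦ B.flip (ψ x)) hsup φ
        simp only [ContinuousLinearMap.flip_apply, sobolevEnergy_zero_left] at h1
        rw [sobolevEnergy_zero_left]; exact h1
      set Y := ENNReal.ofReal (Nψ ^ 2) * ∑ j ∈ Finset.Ico 0 (K + 1 + 1), sobolevEnergy j φ with hY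
      -- `B(∂φ, ψ)` with `h = 0`
      have hA : ∀ i, sobolevEnergy K (fun x ↦ B (fderiv ℝ φ x (e i)) (ψ x)) ≤
          C * ENNReal.ofReal (‖B‖ ^ 2) * (ENNReal.ofReal (Nψ ^ 2) * ∑ j ∈ Finset.Ico 0 (K + 1), sobolevEnergy j (fun x ↦ fderiv ℝ φ x (e i))) := by
        intro i
        have h1 := hC B (hφi i) hψ (h := 0) (by omega) (Mφ := Mφ) (fun j hj ↦ absurd hj (by omega)) hN0
          (fun m (hm : m + 0 ≤ K) x ↦ hNm m (by omega) x)
        rw [highLowQ_eq] at h1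
        simpa using h1
      -- `B(φ, ∂ψ)` with `h = 0`
      have hB' : ∀ i, sobolevEnergy K (fun x ↦ B (φ x) (fderiv ℝ ψ x (e i))) ≤
          C * ENNReal.ofReal (‖B‖ ^ 2) * (ENNReal.ofReal (Nψ ^ 2) * ∑ j ∈ Finset.Ico 0 (K + 1), sobolevEnergy j φ) := by
        intro i
        have hNi : ∀ m, m + 0 ≤ K → ∀ x, ‖iteratedFDeriv ℝ m (fun y ↦ fderiv ℝ ψ y (e i)) x‖ ≤ Nψ := fun m (hm : m + 0 ≤ K) x ↦
          (norm_iteratedFDeriv_fderiv_frame_le hψ m i x).trans (hNm (m + 1) (by omega) x)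
        have h1 := hC B hφ (hψi i) (h := 0) (by omega) (Mφ := Mφ) (fun j hj ↦ absurd hj (by omega)) hN0 hNi
        rw [highLowQ_eq] at h1
        simpa using h1
      rw [highLowQ_eq]
      simp only [Finset.range_zero, Finset.sum_empty, zero_add]
      have hsumA : ∑ i, sobolevEnergy K (fun x ↦ B (fderiv ℝ φ x (e i)) (ψ x)) ≤ C * ENNReal.ofReal (‖B‖ ^ 2) * Y := by
        refine (Finset.sum_le_sum fun i _ ↦ hA i).trans ?_
        rw [← Finset.mul_sum, ← Finset.mul_sum, Finset.sum_comm]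
        refine mul_le_mul' le_rfl (mul_le_mul' le_rfl ?_)
        calc ∑ j ∈ Finset.Ico 0 (K + 1), ∑ i, sobolevEnergy j (fun x ↦ fderiv ℝ φ x (e i))
            ≤ ∑ j ∈ Finset.Ico 0 (K + 1), sobolevEnergy (j + 1) φ := Finset.sum_le_sum fun j _ ↦ sum_sobolevEnergy_fderiv_frame_le j φ
          _ = ∑ j ∈ Finset.Ico (0 + 1) (K + 1 + 1), sobolevEnergy j φ := sum_Ico_sobolevEnergy_succ 0 (K + 1) φ
          _ ≤ ∑ j ∈ Finset.Ico 0 (K + 1 + 1), sobolevEnergy j φ :=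
              Finset.sum_le_sum_of_subset_of_nonneg (Finset.Ico_subset_Ico (by omega) le_rfl) fun _ _ _ ↦ bot_le
      have hsumB : ∑ i, sobolevEnergy K (fun x ↦ B (φ x) (fderiv ℝ ψ x (e i))) ≤ n * (C * ENNReal.ofReal (‖B‖ ^ 2) * Y) := by
        refine (Finset.sum_le_sum fun i _ ↦ (hB' i).trans (mul_le_mul' le_rfl (mul_le_mul' le_rfl
          (Finset.sum_le_sum_of_subset_of_nonneg (Finset.Ico_subset_Ico (le_refl 0) (Nat.le_succ (K + 1))) fun _ _ _ ↦ bot_le)))).trans ?_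
        rw [Finset.sum_const, Finset.card_univ, Fintype.card_fin, nsmul_eq_mul]
      have h0' : (∫⁻ x, ‖B (φ x) (ψ x)‖ₑ ^ 2) ≤ ENNReal.ofReal (‖B‖ ^ 2) * Y := by
        refine h0.trans ?_
        rw [mul_pow, ENNReal.ofReal_mul (sq_nonneg _), mul_assoc]
        refine mul_le_mul' le_rfl (mul_le_mul' le_rfl ?_)
        exact Finset.single_le_sum (f := fun j ↦ sobolevEnergy j φ) (fun _ _ ↦ bot_le) (by simp)
      calc _ ≤ ENNReal.ofReal (‖B‖ ^ 2) * Y + (2 * (C * ENNReal.ofReal (‖B‖ ^ 2) * Y) + 2 * (n * (C * ENNReal.ofReal (‖B‖ ^ 2) * Y))) :=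
            add_le_add h0' (hsum.trans (add_le_add (mul_le_mul' le_rfl hsumA) (mul_le_mul' le_rfl hsumB)))
        _ = (1 + 2 * n * C + 2 * C) * ENNReal.ofReal (‖B‖ ^ 2) * Y := by ring
    · /- `h ≥ 1`: the bottom of `φ` in sup -/
      obtain ⟨h', rfl⟩ : ∃ h', h = h' + 1 := ⟨h - 1, by omega⟩
      -- zeroth term
      have hsup : ∀ x, ‖B (φ x)‖ ≤ ‖B‖ * Mφ 0 := fun x ↦ by
        refine (B.le_opNorm _).trans (mul_le_mul_of_nonneg_left ?_ (norm_nonneg B))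
        have h0 := hM 0 (by omega) x
        rwa [norm_iteratedFDeriv_zero] at h0
      have h0 : (∫⁻ x, ‖B (φ x) (ψ x)‖ₑ ^ 2) ≤ ENNReal.ofReal ((‖B‖ * Mφ 0) ^ 2) * sobolevEnergy 0 ψ := by
        have h1 := sobolevEnergy_clm_apply_le_zero (B := fun x ↦ B (φ x)) hsup ψ
        simp only [sobolevEnergy_zero_left] at h1
        rw [sobolevEnergy_zero_left]; exact h1
      set X := ∑ j ∈ Finset.range (h' + 1), ENNReal.ofReal (Mφ j ^ 2) * sobolevEnergy (K + 1 - j) ψ with hX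
      set Y := ENNReal.ofReal (Nψ ^ 2) * ∑ j ∈ Finset.Ico (h' + 1) (K + 1 + 1), sobolevEnergy j φ with hY
      -- `B(∂φ, ψ)` with split `h'`
      have hA : ∀ i, sobolevEnergy K (fun x ↦ B (fderiv ℝ φ x (e i)) (ψ x)) ≤
          C * ENNReal.ofReal (‖B‖ ^ 2) * ((∑ j ∈ Finset.range h', ENNReal.ofReal (Mφ (j + 1) ^ 2) * sobolevEnergy (K - j) ψ) +
            ENNReal.ofReal (Nψ ^ 2) * ∑ j ∈ Finset.Ico h' (K + 1), sobolevEnergy j (fun x ↦ fderiv ℝ φ x (e i))) := by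
        intro i
        have hMi : ∀ j < h', ∀ x, ‖iteratedFDeriv ℝ j (fun y ↦ fderiv ℝ φ y (e i)) x‖ ≤ Mφ (j + 1) := fun j hj x ↦
          (norm_iteratedFDeriv_fderiv_frame_le hφ j i x).trans (hM (j + 1) (by omega) x)
        have h1 := hC B (hφi i) hψ (h := h') (by omega) (Mφ := fun j ↦ Mφ (j + 1)) hMi hN0 (fun m (hm : m + h' ≤ K) x ↦ hN m (by omega) x)
        rw [highLowQ_eq] at h1
        exact h1
      -- `B(φ, ∂ψ)` with split `min (h' + 1) (K + 1)`
      have hB' : ∀ i, sobolevEnergy K (fun x ↦ B (φ x) (fderiv ℝ ψ x (e i))) ≤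
          C * ENNReal.ofReal (‖B‖ ^ 2) * ((∑ j ∈ Finset.range (min (h' + 1) (K + 1)), ENNReal.ofReal (Mφ j ^ 2) *
            sobolevEnergy (K - j) (fun x ↦ fderiv ℝ ψ x (e i))) +
            ENNReal.ofReal (Nψ ^ 2) * ∑ j ∈ Finset.Ico (min (h' + 1) (K + 1)) (K + 1), sobolevEnergy j φ) := by
        intro i
        have hNi : ∀ m, m + min (h' + 1) (K + 1) ≤ K → ∀ x, ‖iteratedFDeriv ℝ m (fun y ↦ fderiv ℝ ψ y (e i)) x‖ ≤ Nψ :=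
          fun m (hm : m + min (h' + 1) (K + 1) ≤ K) x ↦ (norm_iteratedFDeriv_fderiv_frame_le hψ m i x).trans
            (hN (m + 1) (by rcases le_or_gt (h' + 1) (K + 1) with hle | hlt <;> [rw [min_eq_left hle] at hm; rw [min_eq_right hlt.le] at hm] <;> omega) x)
        have h1 := hC B hφ (hψi i) (h := min (h' + 1) (K + 1)) (min_le_right _ _) (Mφ := Mφ) (fun j hj x ↦ hM j (by omega) x) hN0 hNi
        rw [highLowQ_eq] at h1
        exact h1
      rw [highLowQ_eq]
      -- collect the `B(∂φ, ψ)` terms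
      have hsumA : ∑ i, sobolevEnergy K (fun x ↦ B (fderiv ℝ φ x (e i)) (ψ x)) ≤ C * ENNReal.ofReal (‖B‖ ^ 2) * (n * X + Y) := by
        refine (Finset.sum_le_sum fun i _ ↦ hA i).trans ?_
        rw [← Finset.mul_sum, Finset.sum_add_distrib, Finset.sum_const, Finset.card_univ, Fintype.card_fin, nsmul_eq_mul, ← Finset.mul_sum,
          Finset.sum_comm]
        refine mul_le_mul' le_rfl (add_le_add (mul_le_mul' le_rfl ?_) (mul_le_mul' le_rfl ?_))
        · -- reindex `j ↦ j + 1`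
          rw [hX, Finset.sum_range_succ']
          refine le_trans (Finset.sum_le_sum fun j _ ↦ ?_) le_self_add
          rw [show K + 1 - (j + 1) = K - j by omega]
        · calc ∑ j ∈ Finset.Ico h' (K + 1), ∑ i, sobolevEnergy j (fun x ↦ fderiv ℝ φ x (e i))
              ≤ ∑ j ∈ Finset.Ico h' (K + 1), sobolevEnergy (j + 1) φ := Finset.sum_le_sum fun j _ ↦ sum_sobolevEnergy_fderiv_frame_le j φ
            _ = ∑ j ∈ Finset.Ico (h' + 1) (K + 1 + 1), sobolevEnergy j φ := sum_Ico_sobolevEnergy_succ h' (K + 1) φ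
      -- collect the `B(φ, ∂ψ)` terms
      have hsumB : ∑ i, sobolevEnergy K (fun x ↦ B (φ x) (fderiv ℝ ψ x (e i))) ≤ C * ENNReal.ofReal (‖B‖ ^ 2) * (X + n * Y) := by
        refine (Finset.sum_le_sum fun i _ ↦ hB' i).trans ?_
        rw [← Finset.mul_sum, Finset.sum_add_distrib, Finset.sum_const, Finset.card_univ, Fintype.card_fin, nsmul_eq_mul]
        refine mul_le_mul' le_rfl (add_le_add ?_ ?_)
        · rw [Finset.sum_comm]
          refine le_trans (Finset.sum_le_sum fun j hj ↦ ?_) (Finset.sum_le_sum_of_subset_of_nonneg (Finset.range_mono (min_le_left _ _)) fun _ _ _ ↦ bot_le)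
          rw [← Finset.mul_sum]
          refine mul_le_mul' le_rfl ?_
          have hj' : j ≤ K := by
            have h1 := Finset.mem_range.1 hj
            have h2 : min (h' + 1) (K + 1) ≤ K + 1 := min_le_right _ _
            omega
          rw [show K + 1 - j = (K - j) + 1 by omega]
          exact sum_sobolevEnergy_fderiv_frame_le (K - j) ψ
        · refine mul_le_mul' le_rfl (mul_le_mul' le_rfl ?_)
          rcases le_or_gt (h' + 1) (K + 1) with hle | hlt
          · rw [min_eq_left hle]
            exact Finset.sum_le_sum_of_subset_of_nonneg (Finset.Ico_subset_Ico le_rfl (by omega)) fun _ _ _ ↦ bot_le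
          · rw [min_eq_right hlt.le, Finset.Ico_self, Finset.sum_empty]
            exact bot_le
      have h0' : (∫⁻ x, ‖B (φ x) (ψ x)‖ₑ ^ 2) ≤ ENNReal.ofReal (‖B‖ ^ 2) * (X + Y) := by
        refine h0.trans ?_
        rw [mul_pow, ENNReal.ofReal_mul (sq_nonneg _), mul_assoc]
        refine mul_le_mul' le_rfl (le_trans ?_ le_self_add)
        refine le_trans ?_ (Finset.single_le_sum (f := fun j ↦ ENNReal.ofReal (Mφ j ^ 2) * sobolevEnergy (K + 1 - j) ψ) (fun _ _ ↦ bot_le)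
          (Finset.mem_range.2 (Nat.succ_pos h')))
        exact mul_le_mul' le_rfl (sobolevEnergy_mono (by omega) ψ)
      calc _ ≤ ENNReal.ofReal (‖B‖ ^ 2) * (X + Y) + (2 * (C * ENNReal.ofReal (‖B‖ ^ 2) * (n * X + Y)) + 2 * (C * ENNReal.ofReal (‖B‖ ^ 2) * (X + n * Y))) :=
            add_le_add h0' (hsum.trans (add_le_add (mul_le_mul' le_rfl hsumA) (mul_le_mul' le_rfl hsumB)))
        _ = (1 + 2 * n * C + 2 * C) * ENNReal.ofReal (‖B‖ ^ 2) * (X + Y) := by ring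

/-! ### The sharp high–low bound -/

/-- **The high–low quantity without the top term** (`j = 0` excluded from the sup part).
[cite: TaylorPDEIII2011, Ch. 13, Prop. 3.6] -/
def highLowQ' (K h : ℕ) (Mφ : ℕ → ℝ) (Nψ : ℝ) (φ : E → G₁) (ψ : E → G₂) : ℝ≥0∞ :=
  (∑ j ∈ Finset.Ico 1 h, ENNReal.ofReal (Mφ j ^ 2) * sobolevEnergy (K - j) ψ) +
    ENNReal.ofReal (Nψ ^ 2) * ∑ j ∈ Finset.Ico h (K + 1), sobolevEnergy j φ

omit [FiniteDimensional ℝ E] [MeasurableSpace E] [BorelSpace E] in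
/-- `highLowQ'_eq`: unfolding. [folklore] -/
theorem highLowQ'_eq [FiniteDimensional ℝ E] [MeasurableSpace E] [BorelSpace E] (K h : ℕ) (Mφ : ℕ → ℝ) (Nψ : ℝ) (φ : E → G₁) (ψ : E → G₂) :
    highLowQ' K h Mφ Nψ φ ψ = (∑ j ∈ Finset.Ico 1 h, ENNReal.ofReal (Mφ j ^ 2) * sobolevEnergy (K - j) ψ) +
      ENNReal.ofReal (Nψ ^ 2) * ∑ j ∈ Finset.Ico h (K + 1), sobolevEnergy j φ := rfl

/-- The full quantity splits as top term plus the rest (`h ≥ 1`). [folklore] -/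
theorem highLowQ_succ_eq (K h' : ℕ) (Mφ : ℕ → ℝ) (Nψ : ℝ) (φ : E → G₁) (ψ : E → G₂) :
    highLowQ K (h' + 1) Mφ Nψ φ ψ = ENNReal.ofReal (Mφ 0 ^ 2) * sobolevEnergy K ψ + highLowQ' K (h' + 1) Mφ Nψ φ ψ := by
  rw [highLowQ_eq, highLowQ'_eq, Finset.range_eq_Ico, Finset.sum_eq_sum_Ico_succ_bot (Nat.succ_pos h'), Nat.sub_zero, add_assoc]

/-- `(1 + ε/3)² ≤ 1 + ε` for `0 ≤ ε ≤ 1`. [folklore] -/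
theorem one_add_third_sq_le' {ε : ℝ} (hε : 0 ≤ ε) (hε1 : ε ≤ 1) : (1 + ε / 3) * (1 + ε / 3) ≤ 1 + ε := by nlinarith

/-- **Sharp high–low Leibniz bound for bilinear pairings**: the top term carries the coefficient
`(1 + ε) ‖B‖² M₀²`. For every `K` and `ε ∈ (0, 1]` there is `C < ∞` such that for every
continuous bilinear `B`, smooth `φ, ψ`, split `1 ≤ h ≤ K + 1`, and bounds `‖Dʲφ‖ ≤ M_j` (`j < h`),
`‖Dᵐψ‖ ≤ N` (`m + h ≤ K`):
`E_K(B(φ, ψ)) ≤ (1 + ε) ‖B‖² M₀² E_K(ψ) + C ‖B‖² highLowQ' K h M N φ ψ`.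
[cite: TaylorPDEIII2011, Ch. 13, Prop. 3.6] -/
theorem sobolevEnergy_bilinear_highlow_sharp (K : ℕ) :
    ∀ {ε : ℝ}, 0 < ε → ε ≤ 1 → ∃ C : ℝ≥0∞, C ≠ ⊤ ∧ ∀ (B : G₁ →L[ℝ] G₂ →L[ℝ] F) {φ : E → G₁} {ψ : E → G₂}, ContDiff ℝ ∞ φ → ContDiff ℝ ∞ ψ →
      ∀ {h : ℕ}, 1 ≤ h → h ≤ K + 1 → ∀ {Mφ : ℕ → ℝ} {Nψ : ℝ}, (∀ j < h, ∀ x, ‖iteratedFDeriv ℝ j φ x‖ ≤ Mφ j) → 0 ≤ Nψ →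
        (∀ m, m + h ≤ K → ∀ x, ‖iteratedFDeriv ℝ m ψ x‖ ≤ Nψ) →
        sobolevEnergy K (fun x ↦ B (φ x) (ψ x)) ≤ ENNReal.ofReal ((1 + ε) * (‖B‖ * Mφ 0) ^ 2) * sobolevEnergy K ψ +
          C * ENNReal.ofReal (‖B‖ ^ 2) * highLowQ' K h Mφ Nψ φ ψ := by
  set n : ℝ≥0∞ := (Module.finrank ℝ E : ℝ≥0∞) with hn
  induction K with
  | zero =>
    intro ε hε _
    refine ⟨0, ENNReal.zero_ne_top, ?_⟩
    intro B φ ψ hφ hψ h hh1 hh Mφ Nψ hM hN0 hN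
    have hsup : ∀ x, ‖B (φ x)‖ ≤ ‖B‖ * Mφ 0 := fun x ↦ by
      refine (B.le_opNorm _).trans (mul_le_mul_of_nonneg_left ?_ (norm_nonneg B))
      have h0 := hM 0 (by omega) x
      rwa [norm_iteratedFDeriv_zero] at h0
    refine (sobolevEnergy_clm_apply_le_zero (B := fun x ↦ B (φ x)) hsup ψ).trans ?_
    rw [zero_mul, zero_mul, add_zero]
    refine mul_le_mul' (ENNReal.ofReal_le_ofReal ?_) le_rfl
    nlinarith [sq_nonneg (‖B‖ * Mφ 0)]
  | succ K ih =>
    intro ε hε hε1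
    obtain ⟨C, hCtop, hC⟩ := ih (ε := ε / 3) (by positivity) (by linarith)
    obtain ⟨CA, hCAtop, hCA⟩ := sobolevEnergy_bilinear_highlow (E := E) (G₁ := G₁) (G₂ := G₂) (F := F) K
    set c₁ : ℝ≥0∞ := ENNReal.ofReal (1 + ε / 3) with hc₁
    set c₂ : ℝ≥0∞ := ENNReal.ofReal (1 + (ε / 3)⁻¹) with hc₂
    refine ⟨c₁ * C * (n + 1) + c₂ * CA * (n + 1), ?_, ?_⟩
    · refine ENNReal.add_ne_top.2 ⟨ENNReal.mul_ne_top (ENNReal.mul_ne_top ENNReal.ofReal_ne_top hCtop) (by simp [hn]),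
        ENNReal.mul_ne_top (ENNReal.mul_ne_top ENNReal.ofReal_ne_top hCAtop) (by simp [hn])⟩
    intro B φ ψ hφ hψ h hh1 hh Mφ Nψ hM hN0 hN
    obtain ⟨h', rfl⟩ : ∃ h', h = h' + 1 := ⟨h - 1, by omega⟩
    set e := stdOrthonormalBasis ℝ E with he
    have hφi : ∀ i, ContDiff ℝ ∞ fun y ↦ fderiv ℝ φ y (e i) := fun i ↦ (hφ.fderiv_right (m := ∞) (by norm_cast)).clm_apply contDiff_const
    have hψi : ∀ i, ContDiff ℝ ∞ fun y ↦ fderiv ℝ ψ y (e i) := fun i ↦ (hψ.fderiv_right (m := ∞) (by norm_cast)).clm_apply contDiff_const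
    have hprod : ∀ i, (fun x ↦ fderiv ℝ (fun y ↦ B (φ y) (ψ y)) x (e i)) =
        fun x ↦ B (φ x) (fderiv ℝ ψ x (e i)) + B (fderiv ℝ φ x (e i)) (ψ x) := fun i ↦ funext fun x ↦ by
      rw [fderiv_bilinear_apply B hφ hψ x _, add_comm]
    rw [sobolevEnergy_succ]
    simp only [hprod, ← he]
    have hBφ : ∀ i, ContDiff ℝ K fun x ↦ B (fderiv ℝ φ x (e i)) (ψ x) := fun i ↦
      ((B.contDiff.comp (hφi i)).clm_apply hψ).of_le (by exact_mod_cast le_top)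
    have hBψ : ∀ i, ContDiff ℝ K fun x ↦ B (φ x) (fderiv ℝ ψ x (e i)) := fun i ↦
      ((B.contDiff.comp hφ).clm_apply (hψi i)).of_le (by exact_mod_cast le_top)
    have hsum : ∑ i, sobolevEnergy K (fun x ↦ B (φ x) (fderiv ℝ ψ x (e i)) + B (fderiv ℝ φ x (e i)) (ψ x)) ≤
        c₁ * ∑ i, sobolevEnergy K (fun x ↦ B (φ x) (fderiv ℝ ψ x (e i))) + c₂ * ∑ i, sobolevEnergy K (fun x ↦ B (fderiv ℝ φ x (e i)) (ψ x)) := by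
      rw [Finset.mul_sum, Finset.mul_sum, ← Finset.sum_add_distrib]
      exact Finset.sum_le_sum fun i _ ↦ sobolevEnergy_add_le_eps K (hBψ i) (hBφ i) (by positivity)
    -- zeroth term
    have hsup : ∀ x, ‖B (φ x)‖ ≤ ‖B‖ * Mφ 0 := fun x ↦ by
      refine (B.le_opNorm _).trans (mul_le_mul_of_nonneg_left ?_ (norm_nonneg B))
      have h0 := hM 0 (by omega) x
      rwa [norm_iteratedFDeriv_zero] at h0
    have h0 : (∫⁻ x, ‖B (φ x) (ψ x)‖ₑ ^ 2) ≤ ENNReal.ofReal ((‖B‖ * Mφ 0) ^ 2) * ∫⁻ x, ‖ψ x‖ₑ ^ 2 := by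
      have h1 := sobolevEnergy_clm_apply_le_zero (B := fun x ↦ B (φ x)) hsup ψ
      simp only [sobolevEnergy_zero_left] at h1
      exact h1
    set X' := ∑ j ∈ Finset.Ico 1 (h' + 1), ENNReal.ofReal (Mφ j ^ 2) * sobolevEnergy (K + 1 - j) ψ with hX'
    set Y := ENNReal.ofReal (Nψ ^ 2) * ∑ j ∈ Finset.Ico (h' + 1) (K + 1 + 1), sobolevEnergy j φ with hY
    -- main terms: `B(φ, ∂ψ)` by the sharp hypothesis at level `K`, split `min (h'+1) (K+1)`
    have hmain : ∀ i, sobolevEnergy K (fun x ↦ B (φ x) (fderiv ℝ ψ x (e i))) ≤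
        ENNReal.ofReal ((1 + ε / 3) * (‖B‖ * Mφ 0) ^ 2) * sobolevEnergy K (fun x ↦ fderiv ℝ ψ x (e i)) +
        C * ENNReal.ofReal (‖B‖ ^ 2) * ((∑ j ∈ Finset.Ico 1 (min (h' + 1) (K + 1)), ENNReal.ofReal (Mφ j ^ 2) *
            sobolevEnergy (K - j) (fun x ↦ fderiv ℝ ψ x (e i))) +
          ENNReal.ofReal (Nψ ^ 2) * ∑ j ∈ Finset.Ico (min (h' + 1) (K + 1)) (K + 1), sobolevEnergy j φ) := by
      intro i
      have hNi : ∀ m, m + min (h' + 1) (K + 1) ≤ K → ∀ x, ‖iteratedFDeriv ℝ m (fun y ↦ fderiv ℝ ψ y (e i)) x‖ ≤ Nψ :=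
        fun m (hm : m + min (h' + 1) (K + 1) ≤ K) x ↦ (norm_iteratedFDeriv_fderiv_frame_le hψ m i x).trans
          (hN (m + 1) (by rcases le_or_gt (h' + 1) (K + 1) with hle | hlt <;> [rw [min_eq_left hle] at hm; rw [min_eq_right hlt.le] at hm] <;> omega) x)
      have h1 := hC B hφ (hψi i) (h := min (h' + 1) (K + 1)) (le_min (by omega) (by omega)) (min_le_right _ _) (Mφ := Mφ)
        (fun j hj x ↦ hM j (by omega) x) hN0 hNi
      rw [highLowQ'_eq] at h1
      exact h1
    have hsumMain : ∑ i, sobolevEnergy K (fun x ↦ B (φ x) (fderiv ℝ ψ x (e i))) ≤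
        ENNReal.ofReal ((1 + ε / 3) * (‖B‖ * Mφ 0) ^ 2) * ∑ i, sobolevEnergy K (fun x ↦ fderiv ℝ ψ x (e i)) +
        C * ENNReal.ofReal (‖B‖ ^ 2) * (X' + n * Y) := by
      refine (Finset.sum_le_sum fun i _ ↦ hmain i).trans ?_
      rw [Finset.sum_add_distrib, ← Finset.mul_sum, ← Finset.mul_sum, Finset.sum_add_distrib, Finset.sum_const, Finset.card_univ,
        Fintype.card_fin, nsmul_eq_mul]
      refine add_le_add le_rfl (mul_le_mul' le_rfl (add_le_add ?_ ?_))
      · rw [Finset.sum_comm]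
        refine le_trans (Finset.sum_le_sum fun j hj ↦ ?_)
          (Finset.sum_le_sum_of_subset_of_nonneg (Finset.Ico_subset_Ico le_rfl (min_le_left _ _)) fun _ _ _ ↦ bot_le)
        rw [← Finset.mul_sum]
        refine mul_le_mul' le_rfl ?_
        have hj' : j ≤ K := by
          have h1 := (Finset.mem_Ico.1 hj).2
          have h2 : min (h' + 1) (K + 1) ≤ K + 1 := min_le_right _ _
          omega
        rw [show K + 1 - j = (K - j) + 1 by omega]
        exact sum_sobolevEnergy_fderiv_frame_le (K - j) ψ
      · refine mul_le_mul' le_rfl (mul_le_mul' le_rfl ?_)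
        rcases le_or_gt (h' + 1) (K + 1) with hle | hlt
        · rw [min_eq_left hle]
          exact Finset.sum_le_sum_of_subset_of_nonneg (Finset.Ico_subset_Ico le_rfl (by omega)) fun _ _ _ ↦ bot_le
        · rw [min_eq_right hlt.le, Finset.Ico_self, Finset.sum_empty]
          exact bot_le
    -- secondary terms: `B(∂φ, ψ)` by the crude bound at level `K`, split `h'`
    have hsec : ∀ i, sobolevEnergy K (fun x ↦ B (fderiv ℝ φ x (e i)) (ψ x)) ≤
        CA * ENNReal.ofReal (‖B‖ ^ 2) * ((∑ j ∈ Finset.range h', ENNReal.ofReal (Mφ (j + 1) ^ 2) * sobolevEnergy (K - j) ψ) +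
          ENNReal.ofReal (Nψ ^ 2) * ∑ j ∈ Finset.Ico h' (K + 1), sobolevEnergy j (fun x ↦ fderiv ℝ φ x (e i))) := by
      intro i
      have hMi : ∀ j < h', ∀ x, ‖iteratedFDeriv ℝ j (fun y ↦ fderiv ℝ φ y (e i)) x‖ ≤ Mφ (j + 1) := fun j hj x ↦
        (norm_iteratedFDeriv_fderiv_frame_le hφ j i x).trans (hM (j + 1) (by omega) x)
      have h1 := hCA B (hφi i) hψ (h := h') (by omega) (Mφ := fun j ↦ Mφ (j + 1)) hMi hN0 (fun m (hm : m + h' ≤ K) x ↦ hN m (by omega) x)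
      rw [highLowQ_eq] at h1
      exact h1
    have hsumSec : ∑ i, sobolevEnergy K (fun x ↦ B (fderiv ℝ φ x (e i)) (ψ x)) ≤ CA * ENNReal.ofReal (‖B‖ ^ 2) * (n * X' + Y) := by
      refine (Finset.sum_le_sum fun i _ ↦ hsec i).trans ?_
      rw [← Finset.mul_sum, Finset.sum_add_distrib, Finset.sum_const, Finset.card_univ, Fintype.card_fin, nsmul_eq_mul, ← Finset.mul_sum,
        Finset.sum_comm]
      refine mul_le_mul' le_rfl (add_le_add (mul_le_mul' le_rfl ?_) (mul_le_mul' le_rfl ?_))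
      · rw [hX', Finset.range_eq_Ico]
        have hshift := Finset.sum_Ico_add' (fun j' ↦ ENNReal.ofReal (Mφ j' ^ 2) * sobolevEnergy (K + 1 - j') ψ) 0 h' 1
        rw [zero_add] at hshift
        rw [← hshift]
        refine le_of_eq (Finset.sum_congr rfl fun j _ ↦ ?_)
        simp only [show K + 1 - (j + 1) = K - j by omega]
      · calc ∑ j ∈ Finset.Ico h' (K + 1), ∑ i, sobolevEnergy j (fun x ↦ fderiv ℝ φ x (e i))
            ≤ ∑ j ∈ Finset.Ico h' (K + 1), sobolevEnergy (j + 1) φ := Finset.sum_le_sum fun j _ ↦ sum_sobolevEnergy_fderiv_frame_le j φ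
          _ = ∑ j ∈ Finset.Ico (h' + 1) (K + 1 + 1), sobolevEnergy j φ := sum_Ico_sobolevEnergy_succ h' (K + 1) φ
    -- assemble
    rw [highLowQ'_eq]
    have htop : ENNReal.ofReal ((‖B‖ * Mφ 0) ^ 2) * (∫⁻ x, ‖ψ x‖ₑ ^ 2) +
        c₁ * (ENNReal.ofReal ((1 + ε / 3) * (‖B‖ * Mφ 0) ^ 2) * ∑ i, sobolevEnergy K (fun x ↦ fderiv ℝ ψ x (e i))) ≤
        ENNReal.ofReal ((1 + ε) * (‖B‖ * Mφ 0) ^ 2) * sobolevEnergy (K + 1) ψ := by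
      rw [sobolevEnergy_succ, mul_add, ← mul_assoc, hc₁, ← ENNReal.ofReal_mul (by positivity)]
      refine add_le_add (mul_le_mul' (ENNReal.ofReal_le_ofReal ?_) le_rfl) (mul_le_mul' (ENNReal.ofReal_le_ofReal ?_) le_rfl)
      · nlinarith [sq_nonneg (‖B‖ * Mφ 0)]
      · have h3 := one_add_third_sq_le' hε.le hε1
        have h4 : 0 ≤ (‖B‖ * Mφ 0) ^ 2 := sq_nonneg _
        nlinarith
    calc _ ≤ ENNReal.ofReal ((‖B‖ * Mφ 0) ^ 2) * (∫⁻ x, ‖ψ x‖ₑ ^ 2) +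
          (c₁ * (ENNReal.ofReal ((1 + ε / 3) * (‖B‖ * Mφ 0) ^ 2) * ∑ i, sobolevEnergy K (fun x ↦ fderiv ℝ ψ x (e i)) +
            C * ENNReal.ofReal (‖B‖ ^ 2) * (X' + n * Y)) + c₂ * (CA * ENNReal.ofReal (‖B‖ ^ 2) * (n * X' + Y))) :=
          add_le_add h0 (hsum.trans (add_le_add (mul_le_mul' le_rfl hsumMain) (mul_le_mul' le_rfl hsumSec)))
      _ = (ENNReal.ofReal ((‖B‖ * Mφ 0) ^ 2) * (∫⁻ x, ‖ψ x‖ₑ ^ 2) +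
            c₁ * (ENNReal.ofReal ((1 + ε / 3) * (‖B‖ * Mφ 0) ^ 2) * ∑ i, sobolevEnergy K (fun x ↦ fderiv ℝ ψ x (e i)))) +
          (c₁ * C * ENNReal.ofReal (‖B‖ ^ 2) * (X' + n * Y) + c₂ * CA * ENNReal.ofReal (‖B‖ ^ 2) * (n * X' + Y)) := by ring
      _ ≤ ENNReal.ofReal ((1 + ε) * (‖B‖ * Mφ 0) ^ 2) * sobolevEnergy (K + 1) ψ +
          (c₁ * C * (n + 1) + c₂ * CA * (n + 1)) * ENNReal.ofReal (‖B‖ ^ 2) * (X' + Y) := by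
          refine add_le_add htop ?_
          have h1 : X' + n * Y ≤ (n + 1) * (X' + Y) := by
            calc X' + n * Y ≤ X' + n * Y + (n * X' + Y) := le_self_add
              _ = (n + 1) * (X' + Y) := by ring
          have h2 : n * X' + Y ≤ (n + 1) * (X' + Y) := by
            calc n * X' + Y ≤ n * X' + Y + (n * Y + X') := le_self_add
              _ = (n + 1) * (X' + Y) := by ring
          calc c₁ * C * ENNReal.ofReal (‖B‖ ^ 2) * (X' + n * Y) + c₂ * CA * ENNReal.ofReal (‖B‖ ^ 2) * (n * X' + Y)
              ≤ c₁ * C * ENNReal.ofReal (‖B‖ ^ 2) * ((n + 1) * (X' + Y)) + c₂ * CA * ENNReal.ofReal (‖B‖ ^ 2) * ((n + 1) * (X' + Y)) :=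
                add_le_add (mul_le_mul' le_rfl h1) (mul_le_mul' le_rfl h2)
            _ = (c₁ * C * (n + 1) + c₂ * CA * (n + 1)) * ENNReal.ofReal (‖B‖ ^ 2) * (X' + Y) := by ring

end Literature.Analysis.PDE
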